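import Summits.KontsevichZagierPeriods.KontsevichZagierPeriods.Theorems.SoloBlindQuartic
import Literature.NumberTheory.Transcendental.SemialgebraicRpow
import HarnessLib

/-!
# The twisted quartic splitting `β(x, ½-3x) = 2·64^{-x}·[β(½-x, 4x) + β(4x, ½-3x)]`

Sol Binde (solo-blind track), 2026-08-20.

The quartic correspondence of `SoloBlindQuarticPrep` (maps `φ_A = (1-m)(1+m²)`,
`φ_B = m³/(m²-m+1)`, `ψ = 4m(m²-m+1)/(1+m²)²` on `(0,1)`, `D = m(m²-m+1)`, `A = 1 - D`,
`Φ = D³/A⁴`) realises a SECOND splitting of the Aoki–Shioda quartic family, with the three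
Beta integrands now pulled back to functions sharing the common irrational (but semialgebraic)
factor `1/√D`:

* `β(4x, ½-3x)` along `φ_A`  ↦ `Φ^{-x}(3m²-2m+1)/(A√D)`,
* `β(½-x, 4x)` along `φ_B`   ↦ `Φ^{-x}·m(m²-2m+3)/(A√D)`,
* `β(½-3x, x)` along `ψ`     ↦ `64^{-x}Φ^{-x}·2(1+m)/((1-m)√D)`,

and the pointwise identity `(1+m)(1+m²) = m(m²-2m+3) + (3m²-2m+1)` gives, inside the
Kontsevich–Zagier rules (three substitutions and one additivity, no Stokes step),

  `β(½-3x, x) = 2·64^{-x} • (β(½-x, 4x) + β(4x, ½-3x))`,  `0 < x < 1/6`,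

hence the orbit merge `β(x, ½-3x) ≐ β(½-x, 4x)`: the orbit `{x, ½-3x, ½+2x}` meets the orbit
`{½-x, 4x, ½-3x}`.  Together with `betaQ_propTo_quartic` this covers every first-kind
splitting of the quartic family with `x`-pattern `(1,-4,3)`.
-/

open MeasureTheory Set Real MvPolynomial
open Literature.NumberTheory.Transcendental
open Literature.NumberTheory.Transcendental.KZ
open Literature.NumberTheory.Transcendental.KZ.IntegralRep

noncomputable section

namespace Summit.KontsevichZagierPeriods.KontsevichZagierPeriods.Theorems

namespace SoloBlind

/-! ## The pulled-back integrands -/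

/-- `G'_A(x,m) = Φ^{-x}(3m²-2m+1)/(A√D)`. -/
def qtGA (x : ℚ) (m : ℝ) : ℝ :=
  quPhi m ^ (-(x : ℝ)) * (3 * m ^ 2 - 2 * m + 1) / (quA m * Real.sqrt (quD m))

/-- `G'_B(x,m) = Φ^{-x}·m(m²-2m+3)/(A√D)`. -/
def qtGB (x : ℚ) (m : ℝ) : ℝ :=
  quPhi m ^ (-(x : ℝ)) * (m * (m ^ 2 - 2 * m + 3)) / (quA m * Real.sqrt (quD m))

/-- `G'_C(x,m) = 64^{-x}·Φ^{-x}·2(1+m)/((1-m)√D)`. -/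
def qtGC (x : ℚ) (m : ℝ) : ℝ :=
  (64:ℝ) ^ (-(x : ℝ)) * (quPhi m ^ (-(x : ℝ)) * (2 * (1 + m)) / ((1 - m) * Real.sqrt (quD m)))

/-! ## Keys: the inverse `x`-parts and the square roots -/

/-- `A⁴ D^{-3} = Φ⁻¹`. -/
theorem qt_keyA {m : ℝ} (hm : m ∈ Ioo (0:ℝ) 1) :
    quA m ^ (4:ℤ) * quD m ^ (-3:ℤ) = (quPhi m)⁻¹ := by
  have hA := (quA_pos hm).ne'
  have hD := (quD_pos hm).ne'
  simp only [zpow_neg, zpow_ofNat, quPhi]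
  field_simp

/-- `φ_B^{-1}(1-φ_B)^4 = Φ⁻¹`. -/
theorem qt_keyB {m : ℝ} (hm : m ∈ Ioo (0:ℝ) 1) :
    quB m ^ (-1:ℤ) * (1 - quB m) ^ (4:ℤ) = (quPhi m)⁻¹ := by
  rw [← qu_keyB hm, mul_inv, ← zpow_neg, ← zpow_neg]
  norm_num

/-- `ψ^{-3}(1-ψ) = (64Φ)⁻¹`. -/
theorem qt_keyC {m : ℝ} (hm : m ∈ Ioo (0:ℝ) 1) :
    quS m ^ (-3:ℤ) * (1 - quS m) ^ (1:ℤ) = (64 * quPhi m)⁻¹ := by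
  rw [← qu_keyC hm, mul_inv, ← zpow_neg, ← zpow_neg]
  norm_num

/-- `√φ_B = m√D/(m²-m+1)` on `(0,1)`. -/
theorem qt_sqrt_quB {m : ℝ} (hm : m ∈ Ioo (0:ℝ) 1) :
    Real.sqrt (quB m) = m * Real.sqrt (quD m) / (m ^ 2 - m + 1) := by
  have he := ReflectionThird.sq_sub_add_one_pos m
  have h0 := hm.1
  rw [Real.sqrt_eq_iff_mul_self_eq (quB_mem hm).1.le
    (div_nonneg (mul_nonneg h0.le (Real.sqrt_nonneg _)) he.le),
    div_mul_div_comm, mul_mul_mul_comm, Real.mul_self_sqrt (quD_pos hm).le]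
  unfold quB quD
  field_simp

/-- `φ_B^{-1/2} = (m²-m+1)/(m√D)` on `(0,1)`. -/
theorem qt_sqrtB {m : ℝ} (hm : m ∈ Ioo (0:ℝ) 1) :
    quB m ^ (-(1 / 2 : ℝ)) = (m ^ 2 - m + 1) / (m * Real.sqrt (quD m)) := by
  have he := (ReflectionThird.sq_sub_add_one_pos m).ne'
  have h0 := hm.1.ne'
  have hw := (Real.sqrt_pos.mpr (quD_pos hm)).ne'
  rw [Real.rpow_neg (quB_mem hm).1.le, ← Real.sqrt_eq_rpow, qt_sqrt_quB hm]
  field_simp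

/-- `√ψ = 2√D/(1+m²)` on `(0,1)`. -/
theorem qt_sqrt_quS {m : ℝ} (hm : m ∈ Ioo (0:ℝ) 1) :
    Real.sqrt (quS m) = 2 * Real.sqrt (quD m) / (1 + m ^ 2) := by
  rw [Real.sqrt_eq_iff_mul_self_eq (quS_mem hm).1.le (by positivity),
    div_mul_div_comm, mul_mul_mul_comm, Real.mul_self_sqrt (quD_pos hm).le]
  unfold quS quD
  ring

/-- `ψ^{-1/2} = (1+m²)/(2√D)` on `(0,1)`. -/
theorem qt_sqrtS {m : ℝ} (hm : m ∈ Ioo (0:ℝ) 1) :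
    quS m ^ (-(1 / 2 : ℝ)) = (1 + m ^ 2) / (2 * Real.sqrt (quD m)) := by
  have hw := (Real.sqrt_pos.mpr (quD_pos hm)).ne'
  rw [Real.rpow_neg (quS_mem hm).1.le, ← Real.sqrt_eq_rpow, qt_sqrt_quS hm]
  field_simp

/-! ## The pull-back identities -/

/-- **Pull-back along `φ_A`:** `G'_A = σ^{4x-1}(1-σ)^{-3x-1/2}|φ_A'|`, `σ = φ_A(m)`. -/
theorem qt_pullA (x : ℚ) {m : ℝ} (hm : m ∈ Ioo (0:ℝ) 1) :
    qtGA x m = betaFun (4 * x) (1 / 2 - 3 * x) (quA m) * |quA' m| := by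
  have hA := quA_pos hm
  have hD := quD_pos hm
  have hΦ := quPhi_pos hm
  rw [betaFun, show (((4 * x : ℚ)) : ℝ) - 1 = ((4:ℤ) : ℝ) * (x : ℝ) + (-1) by push_cast; ring,
    show (((1 / 2 - 3 * x : ℚ)) : ℝ) - 1 = ((-3:ℤ) : ℝ) * (x : ℝ) + (-(1 / 2 : ℝ)) by
      push_cast; ring,
    one_sub_quA, qu_master hA hD, qt_keyA hm, Real.inv_rpow hΦ.le, ← Real.rpow_neg hΦ.le,
    Real.rpow_neg_one, Real.rpow_neg hD.le, ← Real.sqrt_eq_rpow, abs_quA']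
  unfold qtGA
  rw [div_eq_mul_inv, mul_inv]
  ring

/-- **Pull-back along `φ_B`:** `G'_B = σ^{-x-1/2}(1-σ)^{4x-1}|φ_B'|`, `σ = φ_B(m)`. -/
theorem qt_pullB (x : ℚ) {m : ℝ} (hm : m ∈ Ioo (0:ℝ) 1) :
    qtGB x m = betaFun (1 / 2 - x) (4 * x) (quB m) * |quB' m| := by
  have hB := quB_mem hm
  have h1B : 0 < 1 - quB m := by linarith [hB.2]
  have hΦ := quPhi_pos hm
  have hA := (quA_pos hm).ne'
  have he := (ReflectionThird.sq_sub_add_one_pos m).ne'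
  have h0 := hm.1.ne'
  have hw := (Real.sqrt_pos.mpr (quD_pos hm)).ne'
  rw [betaFun, show (((1 / 2 - x : ℚ)) : ℝ) - 1 = ((-1:ℤ) : ℝ) * (x : ℝ) + (-(1 / 2 : ℝ)) by
      push_cast; ring,
    show (((4 * x : ℚ)) : ℝ) - 1 = ((4:ℤ) : ℝ) * (x : ℝ) + (-1) by push_cast; ring,
    qu_master hB.1 h1B, qt_keyB hm, Real.inv_rpow hΦ.le, ← Real.rpow_neg hΦ.le,
    Real.rpow_neg_one, qt_sqrtB hm, one_sub_quB, abs_of_pos (quB'_pos hm)]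
  have he2 : m * (m - 1) + 1 ≠ 0 := by
    have : 0 < m * (m - 1) + 1 := by nlinarith [sq_nonneg (m - 1 / 2)]
    exact this.ne'
  unfold qtGB quB'
  field_simp

/-- **Pull-back along `ψ`:** `G'_C = s^{-3x-1/2}(1-s)^{x-1}|ψ'|`, `s = ψ(m)`. -/
theorem qt_pullC (x : ℚ) {m : ℝ} (hm : m ∈ Ioo (0:ℝ) 1) :
    qtGC x m = betaFun (1 / 2 - 3 * x) x (quS m) * |quS' m| := by
  have hS := quS_mem hm
  have h1S := one_sub_quS_pos hm
  have hΦ := quPhi_pos hm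
  have h1 : (1:ℝ) - m ≠ 0 := by linarith [hm.2]
  have hw := (Real.sqrt_pos.mpr (quD_pos hm)).ne'
  rw [betaFun, show (((1 / 2 - 3 * x : ℚ)) : ℝ) - 1 = ((-3:ℤ) : ℝ) * (x : ℝ) + (-(1 / 2 : ℝ)) by
      push_cast; ring,
    show ((x : ℚ) : ℝ) - 1 = ((1:ℤ) : ℝ) * (x : ℝ) + (-1) by push_cast; ring,
    qu_master hS.1 h1S, qt_keyC hm, Real.inv_rpow (by positivity),
    Real.mul_rpow (by norm_num) hΦ.le, mul_inv, ← Real.rpow_neg hΦ.le,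
    ← Real.rpow_neg (by norm_num : (0:ℝ) ≤ 64), Real.rpow_neg_one, qt_sqrtS hm, one_sub_quS,
    abs_of_pos (quS'_pos hm)]
  unfold qtGC quS'
  field_simp
  ring

/-- **Integrand additivity:** `G'_C = 2·64^{-x}·(G'_B + G'_A)` on `(0,1)`, i.e.
`(1+m)(1+m²) = m(m²-2m+3) + (3m²-2m+1)`. -/
theorem qt_add (x : ℚ) {m : ℝ} (hm : m ∈ Ioo (0:ℝ) 1) :
    qtGC x m = 2 * (64:ℝ) ^ (-(x : ℝ)) * qtGB x m + 2 * (64:ℝ) ^ (-(x : ℝ)) * qtGA x m := by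
  have hA := (quA_pos hm).ne'
  have h1 : (1:ℝ) - m ≠ 0 := by linarith [hm.2]
  have hw := (Real.sqrt_pos.mpr (quD_pos hm)).ne'
  unfold qtGA qtGB qtGC
  rw [show quA m = (1 - m) * (1 + m ^ 2) from rfl] at hA ⊢
  field_simp
  ring

/-! ## Integrability (by the change of variables itself) -/

/-- `G'_A` is integrable on `(0,1)` for `0 < x < 1/6`. -/
theorem integrableOn_qtGA (x : ℚ) (hx : 0 < x) (hx6 : 6 * x < 1) :
    IntegrableOn (qtGA x) (Ioo 0 1) := by
  have h := integrableOn_betaFun (4 * x) (1 / 2 - 3 * x) (by positivity) (by linarith)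
  rw [image_quA, integrableOn_image_iff_integrableOn_abs_deriv_smul measurableSet_Ioo
    (fun m _ => (hasDerivAt_quA m).hasDerivWithinAt) injOn_quA] at h
  exact h.congr_fun (fun m hm => by simp only [smul_eq_mul]; rw [mul_comm, ← qt_pullA x hm])
    measurableSet_Ioo

/-- `G'_B` is integrable on `(0,1)` for `0 < x < 1/6`. -/
theorem integrableOn_qtGB (x : ℚ) (hx : 0 < x) (hx6 : 6 * x < 1) :
    IntegrableOn (qtGB x) (Ioo 0 1) := by
  have h := integrableOn_betaFun (1 / 2 - x) (4 * x) (by linarith) (by positivity)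
  rw [image_quB, integrableOn_image_iff_integrableOn_abs_deriv_smul measurableSet_Ioo
    (fun m _ => (hasDerivAt_quB m).hasDerivWithinAt) injOn_quB] at h
  exact h.congr_fun (fun m hm => by simp only [smul_eq_mul]; rw [mul_comm, ← qt_pullB x hm])
    measurableSet_Ioo

/-- `G'_C` is integrable on `(0,1)` for `0 < x < 1/6`. -/
theorem integrableOn_qtGC (x : ℚ) (hx : 0 < x) (hx6 : 6 * x < 1) :
    IntegrableOn (qtGC x) (Ioo 0 1) := by
  have h := integrableOn_betaFun (1 / 2 - 3 * x) x (by linarith) hx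
  rw [image_quS, integrableOn_image_iff_integrableOn_abs_deriv_smul measurableSet_Ioo
    (fun m _ => (hasDerivAt_quS m).hasDerivWithinAt) injOn_quS] at h
  exact h.congr_fun (fun m hm => by simp only [smul_eq_mul]; rw [mul_comm, ← qt_pullC x hm])
    measurableSet_Ioo

/-! ## Semialgebraicity -/

/-- `√D` is `ℚ`-semialgebraic on `(0,1)`. -/
theorem sa_sqrt_quD :
    IsSemialgebraicFunOn ℚ (line (Ioo (0:ℝ) 1)) (fun v : Fin 1 → ℝ => Real.sqrt (quD (v 0))) := by
  have hD : IsSemialgebraicFunOn ℚ (line (Ioo (0:ℝ) 1)) (fun v : Fin 1 → ℝ => quD (v 0)) :=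
    (isSemialgebraicFunOn_aeval mix_line_sa
      (X 0 * (X 0 ^ 2 - X 0 + 1) : MvPolynomial (Fin 1) ℚ)).congr fun v _ => by simp [quD]
  exact (IsSemialgebraicFunOn.rpow_ratCast mix_line_sa hD
    (fun v hv => quD_pos (show v 0 ∈ Ioo (0:ℝ) 1 from hv)) (1 / 2)).congr fun v _ => by
    rw [Real.sqrt_eq_rpow]; norm_num

/-- `Φ^{-x} · p(m) / (r(m) · √D)` is `ℚ`-semialgebraic on `(0,1)` for polynomials `p`, `r` with
`r ≠ 0` there. -/
theorem sa_qt_shape (x : ℚ) (p r : MvPolynomial (Fin 1) ℚ)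
    (hr : ∀ v ∈ line (Ioo (0:ℝ) 1), aeval v r ≠ 0) :
    IsSemialgebraicFunOn ℚ (line (Ioo (0:ℝ) 1))
      (fun v : Fin 1 → ℝ => quPhi (v 0) ^ (-(x : ℝ)) * aeval v p / (aeval v r * Real.sqrt (quD (v 0)))) := by
  have hΦ : IsSemialgebraicFunOn ℚ (line (Ioo (0:ℝ) 1))
      (fun v : Fin 1 → ℝ => quPhi (v 0) ^ (-(x : ℝ))) :=
    (sa_quPhi_rpow (-x)).congr fun v _ => by push_cast; rfl
  exact IsSemialgebraicFunOn.div
    (IsSemialgebraicFunOn.mul_holds hΦ (isSemialgebraicFunOn_aeval mix_line_sa p))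
    (IsSemialgebraicFunOn.mul_holds (isSemialgebraicFunOn_aeval mix_line_sa r) sa_sqrt_quD)
    fun v hv => mul_ne_zero (hr v hv)
      (Real.sqrt_pos.mpr (quD_pos (show v 0 ∈ Ioo (0:ℝ) 1 from hv))).ne'

/-- `A(v 0) ≠ 0` on the line `(0,1)`, polynomial form. -/
theorem qt_aeval_A_ne_zero (v : Fin 1 → ℝ) (hv : v ∈ line (Ioo (0:ℝ) 1)) :
    aeval v ((1 - X 0) * (1 + X 0 ^ 2) : MvPolynomial (Fin 1) ℚ) ≠ 0 := by
  have h := (quA_pos (show v 0 ∈ Ioo (0:ℝ) 1 from hv)).ne'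
  simpa [quA] using h

/-- `G'_A` is `ℚ`-semialgebraic on `(0,1)`. -/
theorem sa_qtGA (x : ℚ) :
    IsSemialgebraicFunOn ℚ (line (Ioo (0:ℝ) 1)) (fun v : Fin 1 → ℝ => qtGA x (v 0)) :=
  (sa_qt_shape x (3 * X 0 ^ 2 - 2 * X 0 + 1) ((1 - X 0) * (1 + X 0 ^ 2)) qt_aeval_A_ne_zero).congr
    fun v _ => by simp [qtGA, quA]

/-- `G'_B` is `ℚ`-semialgebraic on `(0,1)`. -/
theorem sa_qtGB (x : ℚ) :
    IsSemialgebraicFunOn ℚ (line (Ioo (0:ℝ) 1)) (fun v : Fin 1 → ℝ => qtGB x (v 0)) :=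
  (sa_qt_shape x (X 0 * (X 0 ^ 2 - 2 * X 0 + 3)) ((1 - X 0) * (1 + X 0 ^ 2))
    qt_aeval_A_ne_zero).congr fun v _ => by simp [qtGB, quA]

/-- `G'_C` is `ℚ`-semialgebraic on `(0,1)`. -/
theorem sa_qtGC (x : ℚ) :
    IsSemialgebraicFunOn ℚ (line (Ioo (0:ℝ) 1)) (fun v : Fin 1 → ℝ => qtGC x (v 0)) :=
  (IsSemialgebraicFunOn.mul_holds
    (isSemialgebraicFunOn_const_of_isAlgebraic mix_line_sa (qu_isAlgebraic_rpow (-x)))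
    (sa_qt_shape x (2 * (1 + X 0)) (1 - X 0) fun v hv => by
      have h : (1:ℝ) - v 0 ≠ 0 := by
        have hv : v 0 ∈ Ioo (0:ℝ) 1 := hv
        linarith [hv.2]
      simpa using h)).congr fun v _ => by simp [qtGC]

/-! ## The representations and the moves -/

/-- `R'_A = [(0,1), G'_A]`. -/
def qtRA (x : ℚ) (hx : 0 < x) (hx6 : 6 * x < 1) : IntegralRep 1 :=
  lineRep (Ioo 0 1) (qtGA x) mix_line_sa (sa_qtGA x) (integrableOn_qtGA x hx hx6)

/-- `R'_B = [(0,1), G'_B]`. -/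
def qtRB (x : ℚ) (hx : 0 < x) (hx6 : 6 * x < 1) : IntegralRep 1 :=
  lineRep (Ioo 0 1) (qtGB x) mix_line_sa (sa_qtGB x) (integrableOn_qtGB x hx hx6)

/-- `R'_C = [(0,1), G'_C]`. -/
def qtRC (x : ℚ) (hx : 0 < x) (hx6 : 6 * x < 1) : IntegralRep 1 :=
  lineRep (Ioo 0 1) (qtGC x) mix_line_sa (sa_qtGC x) (integrableOn_qtGC x hx hx6)

/-- **Move A:** `R'_A ≡ β(4x, ½-3x)`. -/
theorem qtRA_sub_betaRep (x : ℚ) (hx : 0 < x) (hx6 : 6 * x < 1) :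
    of (qtRA x hx hx6) - of (betaRep (4 * x) (1 / 2 - 3 * x) (by positivity) (by linarith)) ∈
      relations := by
  unfold qtRA betaRep
  exact lineRep_subst quA quA' sa_quA (fun m _ => (hasDerivAt_quA m).hasDerivWithinAt) injOn_quA
    image_quA (fun m hm => qt_pullA x hm)

/-- **Move B:** `R'_B ≡ β(½-x, 4x)`. -/
theorem qtRB_sub_betaRep (x : ℚ) (hx : 0 < x) (hx6 : 6 * x < 1) :
    of (qtRB x hx hx6) - of (betaRep (1 / 2 - x) (4 * x) (by linarith) (by positivity)) ∈
      relations := by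
  unfold qtRB betaRep
  exact lineRep_subst quB quB' sa_quB (fun m _ => (hasDerivAt_quB m).hasDerivWithinAt) injOn_quB
    image_quB (fun m hm => qt_pullB x hm)

/-- **Move C:** `R'_C ≡ β(½-3x, x)`. -/
theorem qtRC_sub_betaRep (x : ℚ) (hx : 0 < x) (hx6 : 6 * x < 1) :
    of (qtRC x hx hx6) - of (betaRep (1 / 2 - 3 * x) x (by linarith) hx) ∈ relations := by
  unfold qtRC betaRep
  exact lineRep_subst quS quS' sa_quS (fun m _ => (hasDerivAt_quS m).hasDerivWithinAt) injOn_quS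
    image_quS (fun m hm => qt_pullC x hm)

/-- **Move D (integrand additivity):** `R'_C ≡ c_x·R'_B + c_x·R'_A`, `c_x = 2·64^{-x}`. -/
theorem qtRC_sub_sub (x : ℚ) (hx : 0 < x) (hx6 : 6 * x < 1) :
    of (qtRC x hx hx6) - of ((qtRB x hx hx6).constMul (2 * (64:ℝ) ^ (-(x : ℝ))) (isAlgebraic_quC x)) -
      of ((qtRA x hx hx6).constMul (2 * (64:ℝ) ^ (-(x : ℝ))) (isAlgebraic_quC x)) ∈ relations :=
  of_sub_sub_mem_relations_of_add rfl rfl fun v hv => by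
    simp only [qtRA, qtRB, qtRC, lineRep_integrand, IntegralRep.integrand_constMul]
    exact qt_add x (show v 0 ∈ Ioo (0:ℝ) 1 from hv)

/-! ## In `Q` -/

/-- **The twisted quartic splitting inside the Kontsevich–Zagier rules:**
`β(½-3x, x) = 2·64^{-x} • (β(½-x, 4x) + β(4x, ½-3x))` for rational `0 < x < 1/6`. -/
theorem betaQ_quarticTwist (x : ℚ) (hx : 0 < x) (hx6 : 6 * x < 1) :
    betaQ (1 / 2 - 3 * x) x =
      quCK x • (betaQ (1 / 2 - x) (4 * x) + betaQ (4 * x) (1 / 2 - 3 * x)) := by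
  have hC : betaQ (1 / 2 - 3 * x) x = mkQ (of (qtRC x hx hx6)) := by
    rw [betaQ_eq (by linarith) hx]
    exact (mkQ_eq_mkQ_iff.mpr (qtRC_sub_betaRep x hx hx6)).symm
  have hA : mkQ (of (qtRA x hx hx6)) = betaQ (4 * x) (1 / 2 - 3 * x) := by
    rw [betaQ_eq (by positivity) (by linarith)]
    exact mkQ_eq_mkQ_iff.mpr (qtRA_sub_betaRep x hx hx6)
  have hB : mkQ (of (qtRB x hx hx6)) = betaQ (1 / 2 - x) (4 * x) := by
    rw [betaQ_eq (by linarith) (by positivity)]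
    exact mkQ_eq_mkQ_iff.mpr (qtRB_sub_betaRep x hx hx6)
  have h2 : mkQ (of (qtRC x hx hx6)) =
      mkQ (of ((qtRB x hx hx6).constMul (2 * (64:ℝ) ^ (-(x : ℝ))) (isAlgebraic_quC x))) +
      mkQ (of ((qtRA x hx hx6).constMul (2 * (64:ℝ) ^ (-(x : ℝ))) (isAlgebraic_quC x))) := by
    rw [← map_add, mkQ_eq_mkQ_iff]
    have h := qtRC_sub_sub x hx hx6
    rwa [sub_sub] at h
  rw [hC, h2, mkQ_constMul, mkQ_constMul, hA, hB, smul_add]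
  rfl

/-- Period check: `B(½-3x, x) = 2·64^{-x}(B(½-x, 4x) + B(4x, ½-3x))`. -/
theorem beta_quarticTwist_value (x : ℚ) (hx : 0 < x) (hx6 : 6 * x < 1) :
    evalQ (betaQ (1 / 2 - 3 * x) x) = 2 * (64:ℝ) ^ (-(x : ℝ)) *
      (evalQ (betaQ (1 / 2 - x) (4 * x)) + evalQ (betaQ (4 * x) (1 / 2 - 3 * x))) := by
  rw [betaQ_quarticTwist x hx hx6, evalQ_smul, map_add, coe_quCK]

/-! ## The orbit merge -/

/-- **Twisted quartic merge: `β(x, ½-3x) ≐ β(½-x, 4x)`** — the orbit of `{x, ½-3x, ½+2x}`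
meets the orbit of `{½-x, 4x, ½-3x}`, for every rational `0 < x < 1/6`.  Precisely
`sin π(½-3x) • β(½-3x, x) = 2·64^{-x}(sin π(½-3x) + sin π(½-x)) • β(4x, ½-x)`. -/
theorem betaQ_propTo_quarticTwist (x : ℚ) (hx : 0 < x) (hx6 : 6 * x < 1) :
    PropTo (betaQ x (1 / 2 - 3 * x)) (betaQ (1 / 2 - x) (4 * x)) := by
  have key := betaQ_quarticTwist x hx hx6
  have hp := orbit_pair (4 * x) (1 / 2 - x) (1 / 2 - 3 * x) (by positivity) (by linarith)
    (by linarith) (by ring)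
  rw [betaQ_symm (show (0:ℚ) < 1 / 2 - 3 * x by linarith) hx] at key
  rw [betaQ_symm (show (0:ℚ) < 1 / 2 - x by linarith) (by positivity)] at key ⊢
  have key' : sinQ (1 / 2 - 3 * x) • betaQ x (1 / 2 - 3 * x) =
      (quCK x * sinQ (1 / 2 - 3 * x)) • betaQ (4 * x) (1 / 2 - x) +
      quCK x • (sinQ (1 / 2 - 3 * x) • betaQ (4 * x) (1 / 2 - 3 * x)) := by
    rw [key, smul_add, smul_add, smul_smul, smul_comm (sinQ _) (quCK x), mul_comm]
  rw [hp, smul_smul] at key'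
  refine PropTo.of_smul_eq_smul (c := sinQ (1 / 2 - 3 * x))
    (c' := quCK x * (sinQ (1 / 2 - 3 * x) + sinQ (1 / 2 - x)))
    (sinQ_ne_zero (by linarith) (by linarith))
    (mul_ne_zero (quCK_ne_zero x)
      (sinQ_add_sinQ_ne_zero (by linarith) (by linarith) (by linarith) (by linarith))) ?_
  linear_combination (norm := module) key'

/-! ## Instances -/

/-- Level `12`: `β(1/12, 1/4) ≐ β(5/12, 1/3)` — `{1,3,8}` meets `{5,4,3}` (also reached by
triplication; here by the quartic correspondence). -/
theorem betaQ_propTo_twelve_qt : PropTo (betaQ (1 / 12) (1 / 4)) (betaQ (5 / 12) (1 / 3)) := by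
  have h := betaQ_propTo_quarticTwist (1 / 12) (by norm_num) (by norm_num)
  norm_num at h
  exact h

/-- Level `24`: `β(1/24, 3/8) ≐ β(11/24, 1/6)` — `{1,9,14}` meets `{11,4,9}`. -/
theorem betaQ_propTo_twentyfour_qt1 :
    PropTo (betaQ (1 / 24) (3 / 8)) (betaQ (11 / 24) (1 / 6)) := by
  have h := betaQ_propTo_quarticTwist (1 / 24) (by norm_num) (by norm_num)
  norm_num at h
  exact h

/-- Level `30`: `β(1/30, 2/5) ≐ β(7/15, 2/15)` — `{1,12,17}` meets `{14,4,12}`. -/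
theorem betaQ_propTo_thirty_qt1 :
    PropTo (betaQ (1 / 30) (2 / 5)) (betaQ (7 / 15) (2 / 15)) := by
  have h := betaQ_propTo_quarticTwist (1 / 30) (by norm_num) (by norm_num)
  norm_num at h
  exact h

end SoloBlind

end Summit.KontsevichZagierPeriods.KontsevichZagierPeriods.Theorems
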